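import Literature.AlgebraicGeometry.Resolution.DiffOpBlowupShiftLawPow
import Literature.AlgebraicGeometry.Resolution.BlowupStalkCharts
import Literature.AlgebraicGeometry.Resolution.StalkIdealLemmas
import HarnessLib

/-!
# Giraud's shift law on the local rings of a blowing up, preserving linearity over `q`-th powers

Topic: `Literature/AlgebraicGeometry/Resolution`. Companion of `DiffOpBlowupStalkShift.lean` (the shift law
`(π^*𝔷)ⁿ · π^*(D h) = (π^*𝔷)^N · Δ(w)` for differential operators of order `≤ n` on the local rings of a blowing up
`IsBlowup π J`) with two refinements, both from `DiffOpBlowupShiftLawPow.lean`: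

* the `k`-algebra structures on the two stalks are ARBITRARY instances, related only by the hypothesis that
  `π^*_{x′}` is compatible with them (`hφk`) — so the statement applies verbatim to the canonical `ℤ`-structures as
  well as to the `k`-structures `stalkAlgebra φ` of a scheme over `k`;
* **linearity over `q`-th powers is preserved**: if `[D, yᵠ] = 0` for all `y ∈ 𝒪_{X,π x′}` then `Δ` may be taken with
  `[Δ, x″ᵠ] = 0` for all `x″ ∈ 𝒪_{X′,x′}` — for `q = pᵉ` in characteristic `p`: `ρᵉ(𝒪_{X,πx′})`-linear operators
  yield `ρᵉ(𝒪_{X′,x′})`-linear ones (the «Frobenius-sandwich» bases).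

`IsBlowup.exists_isDiffOpLE_stalk_shift_pow` — proof as in `DiffOpBlowupStalkShift.lean`: `𝒪_{X′,x′}` is a
localization of a chart `𝒪_{X,x}[J_x/c_j]` (`IsBlowup.exists_reesChart_stalk`, `reesChartEquiv`) and
`(π⁻¹J · 𝒪_{X′})_{x′} = J_x · 𝒪_{X′,x′}` (`stalkIdeal_comap_eq_map_stalkMap`); then
`exists_isDiffOpLE_shift_pow_of_chart`.

Motivation (cell `res-hironaka`, campaign D-0089, row R34; nothing of the manuscript under adjudication is asserted):
the reading-(i) hypothesis shape «(HGsw)» of that row's adjudication; instantiation in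
`Hironaka2017/Proofs/S07Permissible/Thm712GiraudShiftSandwich.lean`.

## Sources

* A. Bravo, M. L. García-Escamilla, O. Villamayor U., arXiv:1107.1797, Lemma 4.6 (Giraud's Lemma) p. 15, §4.
  [BravoGarciaEscamillaVillamayor2012]
* The Stacks Project, Tag 0804 (charts and local rings of a blowing up). [StacksProject]
-/

noncomputable section

open CategoryTheory AlgebraicGeometry TopologicalSpace IsLocalRing IsLocalization

namespace Literature.AlgebraicGeometry.Resolution

universe u v

variable {X X' : Scheme.{u}} {π : X' ⟶ X} {J : X.IdealSheafData} {k : Type v} [CommRing k]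

/-- **Giraud's shift law on the local rings of a blowing up, arbitrary compatible `k`-structures, preserving
linearity over `q`-th powers.** Let `π : X′ → X` be a blowing up along `J` (`IsBlowup π J`), `x′ ∈ X′` with
`J_{π x′}` finitely generated, the stalks `𝒪_{X,π x′}`, `𝒪_{X′,x′}` equipped with `k`-algebra structures compatible
with `π^*_{x′}`, and `𝔷 ∈ 𝒪_{X,π x′}` with `(π^*𝔷) = (π⁻¹J · 𝒪_{X′})_{x′}`. Then for every `k`-linear differential
operator `D` of order `≤ n` of `𝒪_{X,π x′}` with `[D, yᵠ] = 0` for all `y`, and every `N : ℕ`, there is a `k`-linear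
differential operator `Δ` of order `≤ n` of `𝒪_{X′,x′}` with `[Δ, x″ᵠ] = 0` for all `x″` and
`(π^*𝔷)ⁿ · π^*(D h) = (π^*𝔷)^N · Δ(w)` whenever `π^*(h) = (π^*𝔷)^N · w` (`q = 0`: no linearity constraint).
[cite: BravoGarciaEscamillaVillamayor2012, Lemma 4.6 p.15 (Giraud's Lemma) with §4 (operators linear over q-th powers), on the local rings of the blowing up via StacksProject Tag 0804] -/
theorem IsBlowup.exists_isDiffOpLE_stalk_shift_pow (hπ : IsBlowup π J) (x' : X')
    [Algebra k (X.presheaf.stalk (π x'))] [Algebra k (X'.presheaf.stalk x')]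
    (hφk : ∀ c : k, (π.stalkMap x').hom (algebraMap k (X.presheaf.stalk (π x')) c) =
      algebraMap k (X'.presheaf.stalk x') c)
    (hfg : (stalkIdeal J (π x')).FG) (𝔷 : X.presheaf.stalk (π x'))
    (hspan : Ideal.span {(π.stalkMap x').hom 𝔷} = stalkIdeal (J.comap π) x') (q n N : ℕ)
    (D : X.presheaf.stalk (π x') →ₗ[k] X.presheaf.stalk (π x')) (hD : IsDiffOpLE k n D)
    (hq : ∀ y : X.presheaf.stalk (π x'), commMul k D (y ^ q) = 0) :
    ∃ Δ : X'.presheaf.stalk x' →ₗ[k] X'.presheaf.stalk x', IsDiffOpLE k n Δ ∧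
      (∀ x'' : X'.presheaf.stalk x', commMul k Δ (x'' ^ q) = 0) ∧
      ∀ (h : X.presheaf.stalk (π x')) (w : X'.presheaf.stalk x'),
        (π.stalkMap x').hom h = (π.stalkMap x').hom 𝔷 ^ N * w →
          (π.stalkMap x').hom 𝔷 ^ n * (π.stalkMap x').hom (D h) = (π.stalkMap x').hom 𝔷 ^ N * Δ w := by
  -- generators of `J_x` and a chart of `Bl_{J_x}(Spec 𝒪_{X,x})` through `x'`
  obtain ⟨m, c, hc⟩ := Submodule.fg_iff_exists_fin_generating_family.mp hfg
  obtain ⟨j, 𝔴, χ, hχ, hloc, -⟩ := hπ.exists_reesChart_stalk x' c hc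
  have ha : c j ∈ Ideal.span (Set.range c) := Ideal.mem_span_range_self (f := c) (x := j)
  -- `ε : B_j ≅ R[I/c_j]`; `χ' = χ ∘ ε⁻¹ : R[I/c_j] → 𝒪_{X',x'}` presents the stalk as a localization
  have hεb : ∀ r : X.presheaf.stalk (π x'),
      (reesChartEquiv (c j) ha).symm (algebraMap _ (blowupAlgebra (Ideal.span (Set.range c)) (c j)) r) =
        chartBase c j r := fun r => by
    rw [← reesChartEquiv_reesChartBase (c j) ha r, RingEquiv.symm_apply_apply]
  have hχ' : ∀ r : X.presheaf.stalk (π x'),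
      (χ.comp (reesChartEquiv (c j) ha).symm.toRingHom)
        (algebraMap _ (blowupAlgebra (Ideal.span (Set.range c)) (c j)) r) = (π.stalkMap x').hom r := fun r => by
    rw [RingHom.comp_apply, RingEquiv.toRingHom_eq_coe, RingHom.coe_coe, hεb, hχ]
  have hM : @IsLocalization _ _ (𝔴.asIdeal.primeCompl.map (reesChartEquiv (c j) ha).toMonoidHom)
      (X'.presheaf.stalk x') _ (χ.comp (reesChartEquiv (c j) ha).symm.toRingHom).toAlgebra := by
    letI := χ.toAlgebra
    haveI := hloc
    exact IsLocalization.isLocalization_of_base_ringEquiv 𝔴.asIdeal.primeCompl (X'.presheaf.stalk x')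
      (reesChartEquiv (c j) ha)
  -- `(π^*𝔷) = (π⁻¹J 𝒪_{X'})_{x'} = J_x · 𝒪_{X',x'}`
  have hz : Ideal.span {(π.stalkMap x').hom 𝔷} = (Ideal.span (Set.range c)).map (π.stalkMap x').hom := by
    rw [hspan, stalkIdeal_comap_eq_map_stalkMap, ← hc]
  exact exists_isDiffOpLE_shift_pow_of_chart (π.stalkMap x').hom hφk ha
    (χ.comp (reesChartEquiv (c j) ha).symm.toRingHom) hχ' _ hM hz q n N D hD hq

end Literature.AlgebraicGeometry.Resolution

end
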